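import Mathlib
import Summits.ValiantsHypothesis.ValiantsHypothesis.Theorems.LacunarySymmetroidMatrixDescartesCensusDefs
import Summits.ValiantsHypothesis.ValiantsHypothesis.Theorems.LacunarySymmetroidMatrixDescartesStubDescartesCeiling
import Summits.ValiantsHypothesis.ValiantsHypothesis.Theorems.LacunarySymmetroidMatrixDescartesCensusDoorA

/-!
# Tower graft line, stub S4h: the doubling chain (size-induction spine ⇒ TowerB)

By-name closer for the registered stub **S4h `stub_doublingChain : TowerB_of_sizeDoubling`** of the line
`Cruxes/WeakLifting/Lines/tower_graft.lean` (rev 8 @78ef05dfcd86; crux `WeakLifting` = stmt-ValiantsHypothesis-19561,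
restricted sub-case `TowerWeakLifting`; line planner val-idea-24 g0, critic of record val-idea-crit-6 g0 (#7h/#7i), lead g27 R2729).

`doublingChain` is the line's `TowerSizeDoublingPoly → PosRootLawSizeMono → TowerB` VERBATIM with the line defs
`TowerSizeDoublingPoly`, `PosRootLawSizeMono`, `TowerB`, `IsTower` inlined (the tree's `PosRootLawOn` imported), so the line
discharges the stub by `exact doublingChain`.

Content (pure arithmetic + the tree's Descartes ceiling `stub_descartesCeiling`).  Fix the constant `C` of the size-doubling law
(fat form: on formats `2^C·K ≤ s`, on `s`-towers, the class budget at size `2s−1` is `(s+1)^C·B + 2^{C·log₂² s}` whenever it is `B`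
at size `s`).  For a target size `m`, `K ≥ 1` letters and an `m`-tower `d`, run the chain of sizes `s_j = 2^j·n₀ + 1` with
`n₀ = 2^C·K` (so `s_{j+1} = 2 s_j − 1` and the fat guard holds at every `s_j`), carrying the claim
«`PosRootLawOn (min m s_j) K B_j d`» with `B_j = (m+1)^{C j}·(2^{n₀+1+K} + j·2^{C L²})`, `L = log₂ m`:
* `j = 0`: Descartes at size `min m s₀ ≤ s₀` (`ζ₊ + 1 ≤ C(s+K−1, s) ≤ 2^{s+K−1}`);
* `j → j+1`: if `s_j ≥ m` only the budget grows; if `s_j < m` the `m`-tower is an `s_j`-tower, the doubling law applies at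
  `s_j` (factor `(s_j+1)^C ≤ (m+1)^C`, additive term `2^{C log₂² s_j} ≤ 2^{C L²}`), and size monotonicity comes down from
  `s_{j+1}` to `min m s_{j+1}`;
* at `j = L+1`, `s_{L+1} ≥ 2^{L+1} + 1 > m`, so the claim is the class law at size `m` with budget
  `B_{L+1} ≤ 2^{C(L+1)²}·2^{n₀+K+L+CL²+2} ≤ 2^{(2^C+3C+3)(K+L²)}`.
`K = 0` is the empty pencil (no roots).  So TowerB holds with constant `2^C + 3C + 3`.

Def-free; Mathlib + three tree files (route-independent; `…CensusDoorA` only for `Census.posRootLawOn_mono`).  HONEST FRAMING: an arithmetic joint of a skeleton for a RESTRICTED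
sub-case — it makes «size-doubling (S4f, fat polynomial form) + size monotonicity (S4g) ⇒ TowerB» a kernel fact and proves neither
hypothesis; nothing here bears on `WeakLifting` itself, Conjecture B / `KPlusLogSqLaw`, `MatrixDescartes` (18050) or `VP ≠ VNP`.
Seat: prover val-sym-lift-p2 g18, `--supports stmt-ValiantsHypothesis-19561`.
-/

-- `Summit.ValiantsHypothesis.ValiantsHypothesis.…` repeats a component by the D-0017 layout
-- (single-conjunct summit), which the `dupNamespace` linter flags; the name is mandated.
set_option linter.dupNamespace false

namespace Summit.ValiantsHypothesis.ValiantsHypothesis.Theorems.KPlusLogSqLaw.TowerGraft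

open Finset Polynomial Matrix
open scoped BigOperators Polynomial
open Summit.ValiantsHypothesis.ValiantsHypothesis.Theorems.LacunarySymmetroidMatrixDescartes (PosRootLawOn)
open Summit.ValiantsHypothesis.ValiantsHypothesis.Theorems.LacunarySymmetroidMatrixDescartes.Census (posRootLawOn_mono)

/-- the empty format: with no letters the pencil is `0` (or the empty matrix) — no positive zeros. [folklore] -/
theorem posRootLawOn_K_zero (m B : ℕ) (d : Fin 0 → ℕ) : PosRootLawOn m 0 B d := by
  intro S hS
  have h0 : (∑ l : Fin 0, (Polynomial.X : Polynomial ℝ) ^ d l • (S l).map Polynomial.C) = 0 := by simp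
  rw [h0]
  rcases Nat.eq_zero_or_pos m with hm | hm
  · subst hm
    simp [Matrix.det_isEmpty]
  · haveI : Nonempty (Fin m) := ⟨⟨0, hm⟩⟩
    simp [Matrix.det_zero]

/-- **Descartes in the class currency**: every support row holds with budget `2^{m+K}` (`ζ₊ + 1 ≤ C(m+K−1, m) ≤ 2^{m+K−1}`,
`stub_descartesCeiling`; `K = 0` is the empty pencil). [folklore] -/
theorem posRootLawOn_descartes_two_pow (m K : ℕ) (d : Fin K → ℕ) : PosRootLawOn m K (2 ^ (m + K)) d := by
  rcases Nat.eq_zero_or_pos K with hK | hK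
  · subst hK
    exact posRootLawOn_K_zero m _ d
  · intro S _hS
    have h := Summit.ValiantsHypothesis.ValiantsHypothesis.Theorems.LacunarySymmetroidMatrixDescartes.stub_descartesCeiling
      K m hK d S
    have h2 : Nat.choose (m + K - 1) m ≤ 2 ^ (m + K - 1) := Nat.choose_le_two_pow _ _
    have h3 : 2 ^ (m + K - 1) ≤ 2 ^ (m + K) := Nat.pow_le_pow_right (by norm_num) (Nat.sub_le _ _)
    omega

/-- an `m`-tower is an `s`-tower for every `s ≤ m`. [folklore] -/
theorem isTower_of_le {m s K : ℕ} {d : Fin K → ℕ} (hsm : s ≤ m) (hd : ∀ l l' : Fin K, l < l' → m * d l < d l') :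
    ∀ l l' : Fin K, l < l' → s * d l < d l' :=
  fun l l' hll' => lt_of_le_of_lt (Nat.mul_le_mul_right (d l) hsm) (hd l l' hll')

/-- the budget bookkeeping of one doubling step: `A·(A_j·(B₀ + j X)) + X ≤ (A_j A)·(B₀ + (j+1) X)` once `A_j A ≥ 1`. [folklore] -/
theorem chain_budget_step (A Aj B₀ X j : ℕ) (hA : 1 ≤ Aj * A) :
    A * (Aj * (B₀ + j * X)) + X ≤ Aj * A * (B₀ + (j + 1) * X) := by
  nlinarith [Nat.zero_le (Aj * A * B₀), Nat.zero_le (Aj * A * (j * X)), Nat.zero_le X]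

/-- `a ≤ 2^x`, `b ≤ 2^y` ⇒ `a + b ≤ 2^{x+y+1}`. [folklore] -/
theorem add_le_two_pow_of_le {a b x y : ℕ} (ha : a ≤ 2 ^ x) (hb : b ≤ 2 ^ y) : a + b ≤ 2 ^ (x + y + 1) := by
  have h1 : 2 ^ x ≤ 2 ^ (x + y) := Nat.pow_le_pow_right (by norm_num) (Nat.le_add_right x y)
  have h2 : 2 ^ y ≤ 2 ^ (x + y) := Nat.pow_le_pow_right (by norm_num) (Nat.le_add_left y x)
  have h3 : 2 ^ (x + y + 1) = 2 ^ (x + y) * 2 := pow_succ 2 (x + y)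
  omega

/-- the exponent bookkeeping of the whole chain: with `P = 2^C ≥ C`, `K ≥ 1`,
`C(L+1)² + (P K + K + L + C L² + 2) ≤ (P + 3C + 3)(K + L²)`. [folklore] -/
theorem chain_exponent_le (C P K L : ℕ) (hP : C ≤ P) (hK : 1 ≤ K) :
    (L + 1) * (C * (L + 1)) + (P * K + K + L + C * L ^ 2 + 2) ≤ (P + 3 * C + 3) * (K + L ^ 2) := by
  have hL : L ≤ L * L := by
    rcases Nat.eq_zero_or_pos L with h | h
    · simp [h]
    · exact Nat.le_mul_of_pos_left L h
  have hL2 : 2 * L ≤ L * L + 1 := by nlinarith [Nat.zero_le ((L - 1) * (L - 1)), hL]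
  nlinarith [hL, hL2, hK, hP, Nat.zero_le (C * K), Nat.zero_le (P * L * L), Nat.zero_le C]

/-- **S4h `stub_doublingChain` (the line's `TowerB_of_sizeDoubling = TowerSizeDoublingPoly → PosRootLawSizeMono → TowerB`,
verbatim with the line defs `TowerSizeDoublingPoly`, `PosRootLawSizeMono`, `TowerB`, `IsTower` inlined).**  The size-induction
spine: Descartes at the fat start size `2^C·K + 1`, at most `log₂ m + 1` doublings `s ↦ 2s − 1` inside the tower, size
monotonicity down to `m`; TowerB with constant `2^C + 3C + 3`. [this work] -/
theorem doublingChain :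
    (∃ C : ℕ, ∀ (m K B : ℕ) (d : Fin K → ℕ), 2 ^ C * K ≤ m + 1 → (∀ l l' : Fin K, l < l' → (m + 1) * d l < d l') →
      PosRootLawOn (m + 1) K B d → PosRootLawOn (m + 1 + m) K ((m + 2) ^ C * B + 2 ^ (C * Nat.log 2 (m + 1) ^ 2)) d) →
    (∀ (m m' K B : ℕ) (d : Fin K → ℕ), m ≤ m' → PosRootLawOn m' K B d → PosRootLawOn m K B d) →
    (∃ C : ℕ, ∀ (m K : ℕ) (d : Fin K → ℕ), (∀ l l' : Fin K, l < l' → m * d l < d l') →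
      PosRootLawOn m K (2 ^ (C * (K + Nat.log 2 m ^ 2))) d) := by
  rintro ⟨C, hC⟩ hMono
  refine ⟨2 ^ C + 3 * C + 3, fun m K d hd => ?_⟩
  rcases Nat.eq_zero_or_pos K with hK0 | hK
  · subst hK0
    exact posRootLawOn_K_zero m _ d
  -- notation: `L = log₂ m`, start increment `n₀ = 2^C·K` (sizes `s_j = 2^j n₀ + 1`), budgets `B_j`
  set L := Nat.log 2 m with hL
  set n₀ := 2 ^ C * K with hn₀
  have hn₀pos : 1 ≤ n₀ := by
    rw [hn₀]; exact Nat.le_trans hK (Nat.le_mul_of_pos_left K (Nat.two_pow_pos C))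
  -- the chain claim
  have hchain : ∀ j : ℕ, PosRootLawOn (min m (2 ^ j * n₀ + 1)) K
      ((m + 1) ^ (C * j) * (2 ^ (n₀ + 1 + K) + j * 2 ^ (C * L ^ 2))) d := by
    intro j
    induction j with
    | zero =>
      have hdesc := posRootLawOn_descartes_two_pow (min m (2 ^ 0 * n₀ + 1)) K d
      refine posRootLawOn_mono ?_ hdesc
      have h1 : min m (2 ^ 0 * n₀ + 1) + K ≤ n₀ + 1 + K := by
        have : min m (2 ^ 0 * n₀ + 1) ≤ 2 ^ 0 * n₀ + 1 := Nat.min_le_right _ _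
        rw [pow_zero, one_mul] at this ⊢
        omega
      calc 2 ^ (min m (2 ^ 0 * n₀ + 1) + K) ≤ 2 ^ (n₀ + 1 + K) := Nat.pow_le_pow_right (by norm_num) h1
        _ = (m + 1) ^ (C * 0) * (2 ^ (n₀ + 1 + K) + 0 * 2 ^ (C * L ^ 2)) := by simp
    | succ j ih =>
      set s := 2 ^ j * n₀ + 1 with hs
      set Bj := (m + 1) ^ (C * j) * (2 ^ (n₀ + 1 + K) + j * 2 ^ (C * L ^ 2)) with hBj
      have hs' : 2 ^ (j + 1) * n₀ + 1 = s + 2 ^ j * n₀ := by rw [hs, pow_succ]; ring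
      -- budget step
      have hpow : (m + 1) ^ (C * (j + 1)) = (m + 1) ^ (C * j) * (m + 1) ^ C := by
        rw [show C * (j + 1) = C * j + C by ring, pow_add]
      have hstep : (m + 1) ^ C * Bj + 2 ^ (C * L ^ 2) ≤
          (m + 1) ^ (C * (j + 1)) * (2 ^ (n₀ + 1 + K) + (j + 1) * 2 ^ (C * L ^ 2)) := by
        rw [hpow, hBj]
        have h1 : 1 ≤ (m + 1) ^ (C * j) * (m + 1) ^ C :=
          Nat.mul_pos (pow_pos (Nat.succ_pos m) _) (pow_pos (Nat.succ_pos m) _)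
        have := chain_budget_step ((m + 1) ^ C) ((m + 1) ^ (C * j)) (2 ^ (n₀ + 1 + K)) (2 ^ (C * L ^ 2)) j h1
        simpa [Nat.cast_id] using this
      rcases le_or_gt m s with hms | hsm
      · -- the chain has already reached size `m`: only the budget grows
        have hmin : min m s = m := Nat.min_eq_left hms
        have hmin' : min m (2 ^ (j + 1) * n₀ + 1) = m := Nat.min_eq_left (by rw [hs']; omega)
        rw [hmin] at ih
        rw [hmin']
        refine posRootLawOn_mono ?_ ih
        refine le_trans ?_ hstep
        calc Bj ≤ (m + 1) ^ C * Bj := Nat.le_mul_of_pos_left Bj (pow_pos (Nat.succ_pos m) C)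
          _ ≤ (m + 1) ^ C * Bj + 2 ^ (C * L ^ 2) := Nat.le_add_right _ _
      · -- `s < m`: the doubling law applies at size `s = 2^j n₀ + 1`
        have hmin : min m s = s := Nat.min_eq_right (le_of_lt hsm)
        rw [hmin] at ih
        have hguard : 2 ^ C * K ≤ 2 ^ j * n₀ + 1 := by
          rw [hn₀]
          calc 2 ^ C * K ≤ 2 ^ j * (2 ^ C * K) := Nat.le_mul_of_pos_left _ (Nat.two_pow_pos j)
            _ ≤ 2 ^ j * (2 ^ C * K) + 1 := Nat.le_add_right _ _
        have htow : ∀ l l' : Fin K, l < l' → (2 ^ j * n₀ + 1) * d l < d l' := isTower_of_le (le_of_lt hsm) hd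
        have hout := hC (2 ^ j * n₀) K Bj d hguard htow ih
        -- come down to size `min m s_{j+1} ≤ s_{j+1} = s + 2^j n₀`
        have hsize : min m (2 ^ (j + 1) * n₀ + 1) ≤ 2 ^ j * n₀ + 1 + 2 ^ j * n₀ := by
          rw [hs']; exact Nat.min_le_right _ _
        have hdown := hMono _ _ K _ d hsize hout
        refine posRootLawOn_mono (le_trans ?_ hstep) hdown
        -- factor `(s+1)^C ≤ (m+1)^C`, additive term `2^{C log₂² s} ≤ 2^{C L²}`
        have hfac : (2 ^ j * n₀ + 2) ^ C ≤ (m + 1) ^ C := Nat.pow_le_pow_left (by omega) C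
        have hlog : Nat.log 2 (2 ^ j * n₀ + 1) ≤ L := by rw [hL]; exact Nat.log_mono_right (le_of_lt hsm)
        have hadd : 2 ^ (C * Nat.log 2 (2 ^ j * n₀ + 1) ^ 2) ≤ 2 ^ (C * L ^ 2) :=
          Nat.pow_le_pow_right (by norm_num) (Nat.mul_le_mul_left C (Nat.pow_le_pow_left hlog 2))
        exact Nat.add_le_add (Nat.mul_le_mul_right Bj hfac) hadd
  -- at `j = L+1` the chain has passed size `m`
  have hmlt : m < 2 ^ (L + 1) := by rw [hL]; exact Nat.lt_pow_succ_log_self (by norm_num) m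
  have hreach : m ≤ 2 ^ (L + 1) * n₀ + 1 := by
    have : 2 ^ (L + 1) ≤ 2 ^ (L + 1) * n₀ := Nat.le_mul_of_pos_right _ hn₀pos
    omega
  have hfin := hchain (L + 1)
  rw [Nat.min_eq_left hreach] at hfin
  refine posRootLawOn_mono ?_ hfin
  -- final arithmetic: `B_{L+1} ≤ 2^{(2^C + 3C + 3)(K + L²)}`
  have hm1 : m + 1 ≤ 2 ^ (L + 1) := hmlt
  have hA : (m + 1) ^ (C * (L + 1)) ≤ 2 ^ ((L + 1) * (C * (L + 1))) := by
    calc (m + 1) ^ (C * (L + 1)) ≤ (2 ^ (L + 1)) ^ (C * (L + 1)) := Nat.pow_le_pow_left hm1 _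
      _ = 2 ^ ((L + 1) * (C * (L + 1))) := by rw [← pow_mul]
  have hLpow : L + 1 ≤ 2 ^ L := Nat.lt_two_pow_self
  have hB : 2 ^ (n₀ + 1 + K) + (L + 1) * 2 ^ (C * L ^ 2) ≤ 2 ^ ((n₀ + 1 + K) + (L + C * L ^ 2) + 1) := by
    refine add_le_two_pow_of_le le_rfl ?_
    calc (L + 1) * 2 ^ (C * L ^ 2) ≤ 2 ^ L * 2 ^ (C * L ^ 2) := Nat.mul_le_mul_right _ hLpow
      _ = 2 ^ (L + C * L ^ 2) := by rw [← pow_add]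
  have hexp : (L + 1) * (C * (L + 1)) + ((n₀ + 1 + K) + (L + C * L ^ 2) + 1) ≤
      (2 ^ C + 3 * C + 3) * (K + L ^ 2) := by
    have h := chain_exponent_le C (2 ^ C) K L (le_of_lt (Nat.lt_two_pow_self)) hK
    rw [hn₀]
    have : (n₀ + 1 + K) + (L + C * L ^ 2) + 1 = 2 ^ C * K + K + L + C * L ^ 2 + 2 := by rw [hn₀]; ring
    nlinarith [h, this]
  calc (m + 1) ^ (C * (L + 1)) * (2 ^ (n₀ + 1 + K) + (L + 1) * 2 ^ (C * L ^ 2))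
      ≤ 2 ^ ((L + 1) * (C * (L + 1))) * 2 ^ ((n₀ + 1 + K) + (L + C * L ^ 2) + 1) := Nat.mul_le_mul hA hB
    _ = 2 ^ ((L + 1) * (C * (L + 1)) + ((n₀ + 1 + K) + (L + C * L ^ 2) + 1)) := by rw [← pow_add]
    _ ≤ 2 ^ ((2 ^ C + 3 * C + 3) * (K + L ^ 2)) := Nat.pow_le_pow_right (by norm_num) hexp

end Summit.ValiantsHypothesis.ValiantsHypothesis.Theorems.KPlusLogSqLaw.TowerGraft
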